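import Summits.CriticalPhenomena.PercolationContinuityZ3.Theorems.PercNearOneGluingNoHeavyLowerTailSahiCTCLadderRowTwoT
import HarnessLib

/-!
# `NoHeavyLowerTail` (crux stmt-CriticalPhenomena-4575), P3 lane: the row `#dbl = 2` of `(L_4)` (the signs discharged for `t = 4`)

Support file (seat `prim-l12-p3`, gen 26; `--supports stmt-CriticalPhenomena-4575`).  Memo g26 §4.16.  For `t = 4` the five numbers in the
sign conditions of `coeff_ladder_rowTwoT_nonneg_of_signs` are `cH(4,n+1) = ((n+1)³+5(n+1)+6)/6`, `cH(3,n±1) = ((n±1)²+(n±1)+2)/2`,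
`cH(2,n−1) = n`, `cH(2,n−2) = n−1`, and the six multipliers are polynomials in `n` whose Taylor coefficients at `n = 6` are all
nonnegative; hence **`coeff_ladder_four_rowTwo_nonneg`**: row `#dbl = 2` of `(L_4)` for every profile with `τ = #(lev m 1) ≥ 8`.
Nothing is asserted about the crux.
-/

namespace Summit.CriticalPhenomena.PercolationContinuityZ3.Theorems.SahiCTCForms

open Finset MvPolynomial SahiCTCGenFun SahiCTCWeightedLYM

variable {α : Type*} [DecidableEq α] [Fintype α]

omit [DecidableEq α] [Fintype α] in
/-- `6·cH(4,k) = k³ + 5k + 6` for `k ≥ 7`. [this work] -/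
theorem six_mul_cH_four {k : ℕ} (hk : 7 ≤ k) : 6 * (cH 4 k : ℤ) = (k : ℤ) ^ 3 + 5 * k + 6 := by
  unfold cH
  rw [show min 4 (k + 1 - 4) = 4 from by omega]
  simp only [sum_range_succ, sum_range_zero, Nat.choose_zero_right, Nat.choose_one_right, zero_add, Nat.cast_add, Nat.cast_one]
  have h2 : (k.choose 2 : ℤ) * 2 = (k : ℤ) * (k - 1) := by
    have h := Nat.choose_two_right k
    have : k.choose 2 * 2 = k * (k - 1) := by rw [h]; exact Nat.div_mul_cancel (Nat.even_mul_pred_self k).two_dvd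
    have := congrArg (fun x : ℕ => (x : ℤ)) this; push_cast [Nat.cast_sub (show 1 ≤ k by omega)] at this; linarith
  have h3 : (k.choose 3 : ℤ) * 6 = (k : ℤ) * (k - 1) * (k - 2) := by
    have h := Nat.choose_succ_right_eq k 2     -- C(k,3) * 3 = C(k,2) * (k-2)
    have := congrArg (fun x : ℕ => (x : ℤ)) h; push_cast [Nat.cast_sub (show 2 ≤ k by omega)] at this
    nlinarith [this, h2]
  nlinarith [h2, h3]

/-- **ROW `#dbl = 2` OF `(L_4)`** (`τ ≥ 8`): the general certificate with its four signs discharged for `t = 4`. [this work] -/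
theorem coeff_ladder_four_rowTwo_nonneg {𝒳 𝒵 : Finset (Finset α)} (h𝒳 : IsUpperSet (𝒳 : Set (Finset α)))
    (h𝒵 : IsUpperSet (𝒵 : Set (Finset α))) (hX4 : ∀ S ∈ 𝒳, 4 ≤ #S) (hZ4 : ∀ S ∈ 𝒵, 4 ≤ #S)
    {m : α →₀ ℕ} (hm : ∀ i, m i ≤ 2) (hD : #(dbl m) = 2) (hτ : 8 ≤ #(lev m 1)) :
    0 ≤ (ee 4 * (PiP * gf (𝒳 ∩ 𝒵) - gf 𝒳 * gf 𝒵) -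
      gf (bySize (· ≤ 4 - 1) : Finset (Finset α)) * gf (bySize (4 ≤ ·) : Finset (Finset α)) *
        gf ((𝒳 ∩ 𝒵).filter fun S => #S = 4)).coeff m := by
  obtain ⟨n, hn⟩ : ∃ n : ℕ, #(lev m 1) + 2 = n + 4 := ⟨#(lev m 1) - 2, by omega⟩
  have hn6 : 6 ≤ n := by omega
  -- the five numbers, in ℚ
  have e4 : 6 * (cH 4 (n + 1) : ℤ) = ((n : ℤ) + 1) ^ 3 + 5 * (n + 1) + 6 := by
    have := six_mul_cH_four (k := n + 1) (by omega); push_cast at this; linarith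
  have e3 : 2 * (cH 3 (n + 1) : ℤ) = ((n : ℤ) + 1) ^ 2 + (n + 1) + 2 := by
    have := two_mul_cH_three (n := n + 1) (by omega); push_cast at this; linarith
  have e3' : 2 * (cH 3 (n - 1) : ℤ) = ((n : ℤ) - 1) ^ 2 + (n - 1) + 2 := by
    obtain ⟨k, hk⟩ : ∃ k, n = k + 1 := ⟨n - 1, by omega⟩
    rw [hk, Nat.add_sub_cancel]; have := two_mul_cH_three (n := k) (by omega); push_cast; linarith
  have e2 : (cH 2 (n - 1) : ℤ) = n := by
    have h : cH 2 (n - 1) = n - 1 + 1 := by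
      unfold cH; rw [show min 2 (n - 1 + 1 - 2) = 2 from by omega]; simp [sum_range_succ]; omega
    rw [h]; push_cast [Nat.cast_sub (show 1 ≤ n by omega)]; ring
  have e2' : (cH 2 (n - 2) : ℤ) = (n : ℤ) - 1 := by
    have h : cH 2 (n - 2) = n - 2 + 1 := by
      unfold cH; rw [show min 2 (n - 2 + 1 - 2) = 2 from by omega]; simp [sum_range_succ]; omega
    rw [h]; push_cast [Nat.cast_sub (show 2 ≤ n by omega)]; ring
  have q4 : ((cH 4 (n + 1) : ℕ) : ℚ) = (((n : ℚ) + 1) ^ 3 + 5 * ((n : ℚ) + 1) + 6) / 6 := by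
    have h : (6 : ℚ) * ((cH 4 (n + 1) : ℕ) : ℚ) = ((n : ℚ) + 1) ^ 3 + 5 * ((n : ℚ) + 1) + 6 := by exact_mod_cast e4
    linarith
  have q3 : ((cH 3 (n + 1) : ℕ) : ℚ) = (((n : ℚ) + 1) ^ 2 + ((n : ℚ) + 1) + 2) / 2 := by
    have h : (2 : ℚ) * ((cH 3 (n + 1) : ℕ) : ℚ) = ((n : ℚ) + 1) ^ 2 + ((n : ℚ) + 1) + 2 := by exact_mod_cast e3
    linarith
  have q3' : ((cH 3 (n - 1) : ℕ) : ℚ) = (((n : ℚ) - 1) ^ 2 + ((n : ℚ) - 1) + 2) / 2 := by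
    have h : (2 : ℚ) * ((cH 3 (n - 1) : ℕ) : ℚ) = ((n : ℚ) - 1) ^ 2 + ((n : ℚ) - 1) + 2 := by exact_mod_cast e3'
    linarith
  have q2 : ((cH 2 (n - 1) : ℕ) : ℚ) = (n : ℚ) := by exact_mod_cast e2
  have q2' : ((cH 2 (n - 2) : ℕ) : ℚ) = (n : ℚ) - 1 := by exact_mod_cast e2'
  have hk : (0 : ℚ) ≤ (n : ℚ) - 6 := by
    have : ((6 : ℕ) : ℚ) ≤ n := by exact_mod_cast hn6
    push_cast at this; linarith
  have hk2 := mul_nonneg hk hk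
  have hk3 := pow_nonneg hk 3
  have hk4 := pow_nonneg hk 4
  have hk5 := pow_nonneg hk 5
  have hk6 := pow_nonneg hk 6
  have hk7 := pow_nonneg hk 7
  have hk8 := pow_nonneg hk 8
  have hk9 := pow_nonneg hk 9
  have hk10 := pow_nonneg hk 10
  have hk11 := pow_nonneg hk 11
  refine coeff_ladder_rowTwoT_nonneg_of_signs h𝒳 h𝒵 (t := 4) (by norm_num) hX4 hZ4 hm hD hn (by omega) ?_ ?_ ?_ ?_ ?_ ?_
  all_goals
    first
    | refine Int.cast_nonneg_iff.1 (?_ : (0 : ℚ) ≤ _)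
    | refine Int.cast_pos.1 (?_ : (0 : ℚ) < _)
  all_goals
    push_cast
    simp only [q4, q3, q3', q2, q2']
    linarith only [hk, hk2, hk3, hk4, hk5, hk6, hk7, hk8, hk9, hk10, hk11]

end Summit.CriticalPhenomena.PercolationContinuityZ3.Theorems.SahiCTCForms
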